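/-
Copyright: cell pub-balaban-gaps (YM BLITZ Y1, track G1), seat g1-p2 GEN 9 (unit `pub-balaban-gaps-g1-p2`).  Row (D4) NODE O,
OBJECT level, the SITE-FIBRE ALGEBRA OF A GAUGE TRANSFORMATION (carrier-generic): a site gauge `g` (fibre matrices with two-sided
inverses `g⁻`) acts on sections by the site-diagonal `fibD g` (71) and on bond fields by `U_μ(x) ↦ g(x)U_μ(x)g⁻(x + e_μ)`; shifts pass
site-diagonal operators (`S_σ·fibD h = fibD (h ∘ σ)·S_σ`), and the covariant
Laplacian with transport defects (72's `covLap`) is COVARIANT: `Δ_W(U^g) = fibD g·Δ_W(U)·fibD g⁻` ([B9] p. 398: *"All these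
inequalities are invariant with respect to gauge transformations of U"*).  HONEST FRAMING: elementary algebra; nothing of Bałaban's
asserted; (D4) instance 0∕1; NOT BetaPertH, NOT continuum, NOT Clay.
-/
import Summits.QuantumFields.BalabanUV.Gaps.D4WalkBlockShiftStep
import Summits.QuantumFields.BalabanUV.Gaps.D4WalkBlockShiftWeighted
import Summits.QuantumFields.BalabanUV.Gaps.D4WalkBlockContourPath

/-!
# `Gaps.D4WalkBlockGaugeAlgebra` — site gauges: `fibD` algebra, shifts, telescoping along bond paths, covariance of `Δ_W`
# (cell pub-balaban-gaps, seat g1-p2 gen 9)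

HONEST DEPENDENCY (cell pub-balaban, verbatim): continuum YM on T⁴ ⇐ BetaPertH ∧ nine spine estimates (0/9 proved);
BetaPertH ⇐ (D1) ∧ (D4) ∧ CAP+tail.

* §1 (`fibD_mul` is 77's) `fibD_const_one`, `one_add_fibD_sub_one` (`1 + fibD (V − 1) = fibD V`), `fibD_mul_fibD_eq_one`, **`relab_mul_fibD`**
  (`S_σ·fibD h = fibD (h ∘ σ)·S_σ`), **`gauge_shift_term`** (`fibD g·(fibD V·S_σ)·fibD g⁻ = fibD (x ↦ g(x)V(x)g⁻(σx))·S_σ`), `rowSum_fibD`,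
  `fibD_mul_mul_fibD_apply`, `conj_inv_eq` (`(AMB)⁻¹ = AM⁻¹B` for `AB = 1 = BA`) (connected paths `IsPath` and the TELESCOPING
  lemmas live in `D4WalkBlockContourPath`).
* §2 **`covLap_gauge`**: `Δ_W(U^g) = fibD g·Δ_W(U)·fibD g⁻` with `U^g_μ(x) = g(x)U_μ(x)g⁻(x + e_μ)`, `(U^g)⁻_μ(y) = g(y + e_μ)U⁻_μ(y)g⁻(y)`
  (the backward defect read at `y = x − e_μ` literally as the Cor. 3.5 ENDs do).
USE: `D4WalkBlockCovariantGaugeMultiLevel` (covariance of the contour averaging on [4]'s nested family and the gauge transfer of 84's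
Green-function block walk expansion).  Value: bookkeeping; words of row (D4) UNCHANGED.

References: T. Bałaban, Comm. Math. Phys. **99** (1985) 389–434 [B9], p. 398, (3.23) p. 394, (3.50) p. 400, Cor. 3.6 p. 408.
-/

noncomputable section

namespace Summit.QuantumFields.BalabanUV.Gaps.D4WalkBlockGaugeAlgebra

open Metric
open scoped Matrix
open Summit.QuantumFields.BalabanUV.Gaps.D4WalkBlockShiftAlgebra (fibD relab Sfw Sbw fibD_add fibD_local)
open Summit.QuantumFields.BalabanUV.Gaps.D4WalkBlockShiftStep (covLap)
open Summit.QuantumFields.BalabanUV.Gaps.D4WalkBlockShiftWeighted (fibD_mul)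

/-! ## §1. Site-fibre algebra of a gauge: `fibD`, shifts, paths, telescoping -/

section Algebra

variable {X : Type} {F : Type} [Fintype X] [Fintype F] [DecidableEq X] [DecidableEq F]

omit [Fintype X] [Fintype F] in
/-- `fibD (fun _ => 1) = 1`. -/
theorem fibD_const_one : fibD X F (fun _ => (1 : Matrix F F ℂ)) = 1 := by
  ext p q
  unfold fibD
  simp only [Matrix.of_apply, Matrix.one_apply]
  by_cases h : p = q
  · subst h; simp
  · by_cases h1 : p.1 = q.1
    · have h2 : p.2 ≠ q.2 := fun e => h (Prod.ext h1 e)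
      simp [h1, h2, h]
    · simp [h1, h]

omit [Fintype X] [Fintype F] in
/-- `1 + fibD (V − 1) = fibD V` (the transport defect recombined with the identity). -/
theorem one_add_fibD_sub_one (V : X → Matrix F F ℂ) : 1 + fibD X F (fun x => V x - 1) = fibD X F V := by
  have e : (fun x => V x) = fun x => (1 : Matrix F F ℂ) + (V x - 1) := by funext x; abel
  conv_rhs => rw [show V = fun x => V x from rfl, e]
  rw [fibD_add, fibD_const_one]

/-- A gauge with sitewise two-sided inverse: `fibD g · fibD g⁻ = 1`. -/
theorem fibD_mul_fibD_eq_one {g gi : X → Matrix F F ℂ} (h : ∀ x, g x * gi x = 1) : fibD X F g * fibD X F gi = 1 := by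
  classical
  rw [fibD_mul, show (fun x => g x * gi x) = fun _ => (1 : Matrix F F ℂ) from funext h, fibD_const_one]

/-- **Shift past a site-diagonal operator**: `S_σ·fibD h = fibD (h ∘ σ)·S_σ` (`(S_σ f)(x) = f(σx)`). -/
theorem relab_mul_fibD (σ : X → X) (h : X → Matrix F F ℂ) : relab X F σ * fibD X F h = fibD X F (h ∘ σ) * relab X F σ := by
  ext p q
  rw [D4WalkBlockShiftAlgebra.relab_mul_apply, Matrix.mul_apply]
  unfold fibD relab
  simp only [Matrix.of_apply, Function.comp_apply]
  rw [Finset.sum_eq_single (p.1, q.2) (fun r _ hr => ?_) (fun h' => (h' (Finset.mem_univ _)).elim)]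
  · by_cases hq : σ p.1 = q.1
    · have e : q = (σ p.1, q.2) := Prod.ext hq.symm rfl
      rw [if_pos hq, if_pos rfl, if_pos e, mul_one]
    · dsimp only
      rw [if_neg hq, if_pos rfl, if_neg (show ¬q = (σ p.1, q.2) from fun e => hq (by rw [e])), mul_zero]
  · by_cases h1 : p.1 = r.1
    · have hne : q ≠ (σ r.1, r.2) := fun e => hr (Prod.ext h1.symm (by rw [e]))
      rw [if_neg hne, mul_zero]
    · rw [if_neg h1, zero_mul]

/-- **One transport term under the gauge**: `fibD g·(fibD V·S_σ)·fibD g⁻ = fibD (x ↦ g(x)V(x)g⁻(σx))·S_σ`. -/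
theorem gauge_shift_term (g gi V : X → Matrix F F ℂ) (σ : X → X) :
    fibD X F g * (fibD X F V * relab X F σ) * fibD X F gi = fibD X F (fun x => g x * V x * gi (σ x)) * relab X F σ := by
  rw [Matrix.mul_assoc, Matrix.mul_assoc, relab_mul_fibD, ← Matrix.mul_assoc, ← Matrix.mul_assoc, fibD_mul, fibD_mul]
  rfl

omit [DecidableEq F] in
/-- Row sums of a site-diagonal operator are the fibre row sums. -/
theorem rowSum_fibD (g : X → Matrix F F ℂ) (p : X × F) : ∑ q, ‖fibD X F g p q‖ = ∑ b, ‖g p.1 p.2 b‖ := by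
  unfold fibD
  simp only [Matrix.of_apply]
  rw [Fintype.sum_prod_type, Finset.sum_eq_single p.1 (fun x _ hx => Finset.sum_eq_zero fun b _ => by
      rw [if_neg (Ne.symm hx), norm_zero]) (fun h' => (h' (Finset.mem_univ _)).elim)]
  simp

omit [DecidableEq F] in
/-- Entries of `fibD g · M · fibD g⁻`: the `(x, x′)` fibre block is `g(x)·M_{x,x′}·g⁻(x′)`. -/
theorem fibD_mul_mul_fibD_apply (g gi : X → Matrix F F ℂ) (M : Matrix (X × F) (X × F) ℂ) (p q : X × F) :
    (fibD X F g * M * fibD X F gi) p q = (g p.1 * (Matrix.of fun a b => M (p.1, a) (q.1, b)) * gi q.1) p.2 q.2 := by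
  rw [Matrix.mul_apply, Matrix.mul_apply]
  unfold fibD
  simp only [Matrix.of_apply, Matrix.mul_apply]
  rw [Fintype.sum_prod_type, Finset.sum_eq_single q.1 (fun x _ hx => Finset.sum_eq_zero fun b _ => by
      rw [if_neg hx, mul_zero]) (fun h' => (h' (Finset.mem_univ _)).elim)]
  refine Finset.sum_congr rfl fun b _ => ?_
  rw [if_pos rfl, Fintype.sum_prod_type, Finset.sum_eq_single p.1 (fun x _ hx => Finset.sum_eq_zero fun a _ => by
      rw [if_neg (Ne.symm hx), zero_mul]) (fun h' => (h' (Finset.mem_univ _)).elim)]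
  simp only [if_true]

/-- `(A·M·B)⁻¹ = A·M⁻¹·B` for a two-sided inverse pair `AB = 1 = BA` (square matrices). -/
theorem conj_inv_eq {n : Type} [Fintype n] [DecidableEq n] (A B M : Matrix n n ℂ) (hAB : A * B = 1) (hBA : B * A = 1) :
    (A * M * B)⁻¹ = A * M⁻¹ * B := by
  rw [Matrix.mul_inv_rev, Matrix.mul_inv_rev, Matrix.inv_eq_left_inv hAB, Matrix.inv_eq_left_inv hBA, Matrix.mul_assoc]

end Algebra

/-! ## §2. Gauge covariance of the covariant Laplacian, of the contour averaging, of the Green function; the transfer -/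

section Covariance

variable {X : Type} {F : Type} [Fintype X] [Fintype F] [DecidableEq X] [DecidableEq F] {ι : Type} [Fintype ι]
variable (sh : ι → X ≃ X) (η : ℝ) {E : Type*} [NormedAddCommGroup E] [NormedSpace ℂ E]
variable (U Ui : ι → E → X → Matrix F F ℂ) {g gi : X → Matrix F F ℂ}

omit [NormedAddCommGroup E] [NormedSpace ℂ E] in
/-- **GAUGE COVARIANCE OF THE COVARIANT LAPLACIAN** (carrier-generic): with `U^g_μ(x) = g(x)U_μ(x)g⁻(x + e_μ)` and the backward
defect `(U^g)⁻_μ(y) = g(y + e_μ)U⁻_μ(y)g⁻(y)` read at `y = x − e_μ` (literally, `g(sh(sh⁻¹x))` unreduced, as the Cor. 3.5 ENDs instantiate it),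
`Δ_W(U^g) = fibD g · Δ_W(U) · fibD g⁻`. [cite: Balaban1985BackgroundPropagators, p.398, (3.50) p.400, (3.23) p.394] -/
theorem covLap_gauge (hg : ∀ x, g x * gi x = 1) (u : E) :
    covLap X F sh η (fun ν u x => g x * U ν u x * gi (sh ν x) - 1)
        (fun ν u x => g (sh ν ((sh ν).symm x)) * Ui ν u ((sh ν).symm x) * gi ((sh ν).symm x) - 1) u =
      fibD X F g * covLap X F sh η (fun ν u x => U ν u x - 1) (fun ν u x => Ui ν u ((sh ν).symm x) - 1) u * fibD X F gi := by
  have e : (fun ν (u : E) x => g (sh ν ((sh ν).symm x)) * Ui ν u ((sh ν).symm x) * gi ((sh ν).symm x) - 1) =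
      fun ν u x => g x * Ui ν u ((sh ν).symm x) * gi ((sh ν).symm x) - 1 := by
    funext ν u x; rw [Equiv.apply_symm_apply]
  rw [e]
  unfold covLap
  simp only [one_add_fibD_sub_one]
  rw [Matrix.mul_smul, Matrix.smul_mul, Finset.mul_sum, Finset.sum_mul]
  refine congrArg _ (Finset.sum_congr rfl fun μ _ => ?_)
  rw [Matrix.mul_sub, Matrix.mul_sub, Matrix.sub_mul, Matrix.sub_mul, Matrix.mul_smul, Matrix.smul_mul, Matrix.mul_one,
    fibD_mul_fibD_eq_one hg]
  unfold Sfw Sbw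
  rw [gauge_shift_term, gauge_shift_term]

end Covariance

end Summit.QuantumFields.BalabanUV.Gaps.D4WalkBlockGaugeAlgebra

end
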